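import Summits.ValiantsHypothesis.ValiantsHypothesis.Theorems.LacunarySymmetroidMatrixDescartesWLawNotSharp
import Summits.ValiantsHypothesis.ValiantsHypothesis.Theorems.LacunarySymmetroidMatrixDescartesCensusEndWindowRev

/-!
# `MatrixDescartes` (stmt-ValiantsHypothesis-18050) — LEADING COEFFICIENTS OF A LACUNARY PENCIL BY REFLECTION, and
# «PSD LETTERS AT BOTH ENDS»: `Z₊ ≤ C(m+K, m+1) − 3` (two below the count-vector ceiling)

HONEST FRAMING.  Cell `pub-symmetroid`, seat `val-sym-mdr-p2` (gen 26); helper file `--supports` the crux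
`Theses.LacunarySymmetroid.MatrixDescartes` (OPEN), NO closure claim.  Companion of `…PencilTrailingCoeffs` (trailing coefficients) and
`…WLawNotSharp` (the four-letter column is never Descartes-sharp).  Statements about ONE real lacunary pencil `F = ∑ l, X^{d l} • S l`
(size `m + 1`, `K` letters, letters ARBITRARY real unless said otherwise); nothing here bears on `MatrixDescartes` in its window, on
`stub_twoSided`, on `DoorA26` / `DoorA34`, on the cell's registers, or on `VP ≠ VNP`.

WHAT IS PROVED (ns `PencilEnds`).
* `coeff_det_pencil_reflect` — reflecting the exponents (`d l ↦ N − d l`, `d l ≤ N`) reflects the coefficient sequence of the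
  determinant: `coeff_{(m+1)N − n} (det F^refl) = coeff_n (det F)`.
* LEADING COEFFICIENTS (from the trailing ones of `…PencilTrailingCoeffs` by reflection): **`coeff_det_pencil_top`** (strictly largest
  exponent at `k₀` ⇒ coefficient of `X^{(m+1)·d k₀}` is `det (S k₀)`), **`coeff_det_pencil_topNext`** (strictly second largest at `k₁` ⇒
  coefficient of `X^{m·d k₀ + d k₁}` is `tr (adj (S k₀) · S k₁)`), `lt_topNext_of_mem_support` (every other support exponent is smaller).
* `signVariations_le_of_ends_nonneg` — two non-negative coefficients BELOW and two ABOVE the rest of the support lose one sign change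
  at each end: `V(C a X^D + C b X^{D'} + R + C c X^{E'} + C c' X^{E}) ≤ #supp R + 1`.
* **`card_posRoots_det_pencil_le_of_ends_posSemidef`** — PSD letters on the two strictly lowest AND on the two strictly highest
  exponents ⇒ `Z₊ ≤ C(m+K, m+1) − 3` (two below the count-vector ceiling `C(m+K, m+1) − 1` of `stub_descartesCeiling`); in particular
  every two-sided pivot pencil with at least two PSD letters strictly on each side of the pivot and pairwise distinct extreme exponents
  (the `(2|1|2)` Cameron–Psarrakos shape and wider) is two short of Descartes-sharp, at every size.
* **`card_posRoots_det_pencil_le_of_top_two_posSemidef`** — the mirror of `WLawNotSharp.card_posRoots_det_pencil_le_of_bot_two_posSemidef`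
  (two PSD letters on the two strictly highest exponents ⇒ `Z₊ ≤ C(m+K, m+1) − 2`).

[folklore] Leibniz expansion and the kit of the two companions; Descartes' rule of signs (Mathlib).  No definitions, no named facts.
-/

-- `Summit.ValiantsHypothesis.ValiantsHypothesis.…` repeats a component by the single-conjunct
-- summit layout, which the `dupNamespace` linter flags; the name is mandated.
set_option linter.dupNamespace false

namespace Summit.ValiantsHypothesis.ValiantsHypothesis.Theorems.LacunarySymmetroidMatrixDescartes

open Polynomial Finset Matrix TrailingCoeffs WLawNotSharp
open scoped BigOperators Polynomial Matrix

namespace PencilEnds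

variable {K m : ℕ}

/-! ### 1. Reflection of the exponents reflects the coefficient sequence -/

/-- Exponent of a row-to-letter map under reflection: `∑ᵢ (N − d (f i)) = (m+1)·N − ∑ᵢ d (f i)` (`d ≤ N`). [folklore] -/
theorem sum_reflect_eq (d : Fin K → ℕ) {N : ℕ} (hN : ∀ l, d l ≤ N) (f : Fin (m + 1) → Fin K) :
    (∑ i, (N - d (f i))) = (m + 1) * N - ∑ i, d (f i) := by
  have h1 : (∑ i, (N - d (f i))) + ∑ i, d (f i) = (m + 1) * N := by
    rw [← Finset.sum_add_distrib, Finset.sum_congr rfl fun i _ => Nat.sub_add_cancel (hN (f i))]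
    simp
  omega

/-- Every exponent of a row-to-letter map is at most `(m+1)·N` (`d ≤ N`). [folklore] -/
theorem sum_le_mul (d : Fin K → ℕ) {N : ℕ} (hN : ∀ l, d l ≤ N) (f : Fin (m + 1) → Fin K) :
    (∑ i, d (f i)) ≤ (m + 1) * N :=
  (Finset.sum_le_sum fun i _ => hN (f i)).trans (by simp)

/-- **Reflection of the coefficient sequence**: with `d l ≤ N` for all `l` and `n ≤ (m+1)·N`,
`coeff_{(m+1)N − n} det (∑ X^{N − d l} • S l) = coeff_n det (∑ X^{d l} • S l)`. [folklore] -/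
theorem coeff_det_pencil_reflect (d : Fin K → ℕ) (S : Fin K → Matrix (Fin (m + 1)) (Fin (m + 1)) ℝ) {N : ℕ}
    (hN : ∀ l, d l ≤ N) {n : ℕ} (hn : n ≤ (m + 1) * N) :
    (Matrix.det (∑ l, ((X : ℝ[X]) ^ (N - d l)) • (S l).map C)).coeff ((m + 1) * N - n)
      = (Matrix.det (∑ l, ((X : ℝ[X]) ^ d l) • (S l).map C)).coeff n := by
  rw [coeff_det_pencil_eq (fun l => N - d l) S, coeff_det_pencil_eq d S]
  refine Finset.sum_congr rfl fun σ _ => Finset.sum_congr rfl fun f _ => ?_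
  have h1 := sum_reflect_eq d hN f
  have h2 := sum_le_mul d hN f
  by_cases h : n = ∑ i, d (f i)
  · rw [if_pos h, if_pos (by rw [h1]; omega)]
  · rw [if_neg h, if_neg (by rw [h1]; omega)]

/-- **The reflected pencil has the reflected determinant**: `det (∑ X^{N − d l} • S l) = reflect ((m+1)·N) (det (∑ X^{d l} • S l))`
(`d l ≤ N`). [folklore] -/
theorem det_pencil_reflect_eq (d : Fin K → ℕ) (S : Fin K → Matrix (Fin (m + 1)) (Fin (m + 1)) ℝ) {N : ℕ}
    (hN : ∀ l, d l ≤ N) :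
    Matrix.det (∑ l, ((X : ℝ[X]) ^ (N - d l)) • (S l).map C)
      = reflect ((m + 1) * N) (Matrix.det (∑ l, ((X : ℝ[X]) ^ d l) • (S l).map C)) := by
  classical
  ext i
  rw [coeff_reflect]
  by_cases hi : i ≤ (m + 1) * N
  · rw [revAt_le hi, ← coeff_det_pencil_reflect d S hN (Nat.sub_le _ i), Nat.sub_sub_self hi]
  · push Not at hi
    rw [revAt_eq_self_of_lt hi]
    -- both coefficients vanish above the top exponent
    rw [StubDescartesCeiling.coeff_det_pencil_eq_zero _ S, StubDescartesCeiling.coeff_det_pencil_eq_zero d S]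
    · intro f hf
      exact absurd (hf.symm.le.trans (sum_le_mul d hN f)) (not_le.mpr hi)
    · intro f hf
      have h := sum_le_mul (fun l => N - d l) (N := N) (fun l => Nat.sub_le N (d l)) f
      rw [hf] at h
      exact absurd h (not_le.mpr hi)

/-! ### 2. Leading coefficients -/

/-- **Leading coefficient of a lacunary pencil**: if the letter `k₀` carries the strictly largest exponent then the coefficient of
`X^{(m+1)·d k₀}` is `det (S k₀)`. [folklore] -/
theorem coeff_det_pencil_top (d : Fin K → ℕ) (S : Fin K → Matrix (Fin (m + 1)) (Fin (m + 1)) ℝ) {k₀ : Fin K}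
    (htop : ∀ l, l ≠ k₀ → d l < d k₀) :
    (Matrix.det (∑ l, ((X : ℝ[X]) ^ d l) • (S l).map C)).coeff ((m + 1) * d k₀) = (S k₀).det := by
  have hN : ∀ l, d l ≤ d k₀ := fun l => by
    by_cases h : l = k₀
    · rw [h]
    · exact (htop l h).le
  have h := coeff_det_pencil_reflect d S hN (le_refl ((m + 1) * d k₀))
  rw [Nat.sub_self] at h
  rw [← h, show (0 : ℕ) = (m + 1) * (d k₀ - d k₀) by simp]
  exact coeff_det_pencil_bot (fun l => d k₀ - d l) S (l₀ := k₀) fun l hl => by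
    have := htop l hl; have := hN l; omega

/-- **Second leading coefficient**: if `k₀` carries the strictly largest and `k₁` the strictly second largest exponent then the
coefficient of `X^{m·d k₀ + d k₁}` is `tr (adj (S k₀) · S k₁)`. [folklore] -/
theorem coeff_det_pencil_topNext (d : Fin K → ℕ) (S : Fin K → Matrix (Fin (m + 1)) (Fin (m + 1)) ℝ) {k₀ k₁ : Fin K}
    (h01 : d k₁ < d k₀) (hnext : ∀ l, l ≠ k₀ → l ≠ k₁ → d l < d k₁) :
    (Matrix.det (∑ l, ((X : ℝ[X]) ^ d l) • (S l).map C)).coeff (m * d k₀ + d k₁) = ((S k₀).adjugate * S k₁).trace := by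
  have hN : ∀ l, d l ≤ d k₀ := fun l => by
    by_cases h : l = k₀
    · rw [h]
    · by_cases h' : l = k₁
      · rw [h']; exact h01.le
      · exact ((hnext l h h').trans h01).le
  have hle : m * d k₀ + d k₁ ≤ (m + 1) * d k₀ := by nlinarith
  have h := coeff_det_pencil_reflect d S hN hle
  have hexp : (m + 1) * d k₀ - (m * d k₀ + d k₁) = m * (d k₀ - d k₀) + (d k₀ - d k₁) := by
    have : (m + 1) * d k₀ = m * d k₀ + d k₀ := by ring
    rw [Nat.sub_self, mul_zero, zero_add]; omega
  rw [← h, hexp]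
  exact coeff_det_pencil_botNext (fun l => d k₀ - d l) S (l₀ := k₀) (l₁ := k₁) (by omega)
    fun l hl hl' => by have := hnext l hl hl'; have := hN l; omega

/-- Every support exponent other than the two leading ones is smaller than `m·d k₀ + d k₁`. [folklore] -/
theorem lt_topNext_of_mem_support (d : Fin K → ℕ) (S : Fin K → Matrix (Fin (m + 1)) (Fin (m + 1)) ℝ) {k₀ k₁ : Fin K}
    (h01 : d k₁ < d k₀) (hnext : ∀ l, l ≠ k₀ → l ≠ k₁ → d l < d k₁) {E : ℕ}
    (hE : E ∈ (Matrix.det (∑ l, ((X : ℝ[X]) ^ d l) • (S l).map C)).support) (hE0 : E ≠ (m + 1) * d k₀)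
    (hE1 : E ≠ m * d k₀ + d k₁) : E < m * d k₀ + d k₁ := by
  classical
  have hN : ∀ l, d l ≤ d k₀ := fun l => by
    by_cases h : l = k₀
    · rw [h]
    · by_cases h' : l = k₁
      · rw [h']; exact h01.le
      · exact ((hnext l h h').trans h01).le
  -- `E` is an exponent of some map, hence `≤ (m+1)·d k₀`
  have hEle : E ≤ (m + 1) * d k₀ := by
    by_contra hlt
    exact (mem_support_iff.mp hE) (StubDescartesCeiling.coeff_det_pencil_eq_zero d S fun f hf =>
      absurd (hf.symm.le.trans (sum_le_mul d hN f)) hlt)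
  have hE' : (m + 1) * d k₀ - E ∈ (Matrix.det (∑ l, ((X : ℝ[X]) ^ (d k₀ - d l)) • (S l).map C)).support := by
    rw [mem_support_iff, coeff_det_pencil_reflect d S hN hEle]
    exact mem_support_iff.mp hE
  have hring : (m + 1) * d k₀ = m * d k₀ + d k₀ := by ring
  have h := botNext_lt_of_mem_support (fun l => d k₀ - d l) S (l₀ := k₀) (l₁ := k₁) (by omega)
    (fun l hl hl' => by have := hnext l hl hl'; have := hN l; omega) hE'
    (by rw [Nat.sub_self, mul_zero]; omega) (by rw [Nat.sub_self, mul_zero, zero_add]; omega)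
  rw [Nat.sub_self, mul_zero, zero_add] at h
  omega

/-! ### 3. Two non-negative coefficients at each end -/

/-- **Ends lemma**: `0 ≤ a, b, c, c'`, `D < D' < supp R < E' < E` ⇒
`V(C a X^D + C b X^{D'} + R + C c X^{E'} + C c' X^{E}) ≤ #supp R + 1` (one sign change is lost at each end). [folklore] -/
theorem signVariations_le_of_ends_nonneg {a b c c' : ℝ} (ha : 0 ≤ a) (hb : 0 ≤ b) (hc : 0 ≤ c) (hc' : 0 ≤ c')
    {D D' E' E : ℕ} (hD : D < D') (hE : E' < E) (hDE : D' < E') {R : ℝ[X]} (hRlo : ∀ i ∈ R.support, D' < i)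
    (hRhi : ∀ i ∈ R.support, i < E') :
    (C a * X ^ D + C b * X ^ D' + R + C c * X ^ E' + C c' * X ^ E).signVariations ≤ R.support.card + 1 := by
  -- the bottom block `g = C a X^D + C b X^{D'} + R` has `V(g) ≤ #supp R` and degree `< E'`
  set g := C a * X ^ D + C b * X ^ D' + R with hg
  have hVg : g.signVariations ≤ R.support.card := signVariations_le_card_support_of_bot_two_nonneg ha hb hD hRlo
  have hgdeg : g.degree < ((E' : ℕ) : WithBot ℕ) := by
    rw [degree_lt_iff_coeff_zero]
    intro i hi
    have hi' : E' ≤ i := by exact_mod_cast hi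
    rw [hg, coeff_add, coeff_add, coeff_C_mul_X_pow, coeff_C_mul_X_pow, if_neg (by omega), if_neg (by omega), zero_add,
      zero_add]
    by_contra hne
    exact absurd (hRhi i (mem_support_iff.mpr hne)) (not_lt.mpr hi')
  have hEE : ((E' : ℕ) : WithBot ℕ) < ((E : ℕ) : WithBot ℕ) := by exact_mod_cast hE
  have hg'deg : (C c * X ^ E' + g).degree < ((E : ℕ) : WithBot ℕ) :=
    (degree_add_le _ _).trans_lt (max_lt ((degree_C_mul_X_pow_le E' c).trans_lt hEE) (hgdeg.trans hEE))
  -- `V(C c X^{E'} + g) ≤ V(g) + 1`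
  have hmid : (C c * X ^ E' + g).signVariations ≤ R.support.card + 1 := by
    rcases hc.eq_or_lt with hc0 | hc0
    · rw [← hc0, C_0, zero_mul, zero_add]; exact hVg.trans (Nat.le_succ _)
    · exact (Literature.Algebra.Polynomial.signVariations_C_mul_X_pow_add_le hc0.ne' hgdeg).trans (by omega)
  have hrw : C a * X ^ D + C b * X ^ D' + R + C c * X ^ E' + C c' * X ^ E = C c' * X ^ E + (C c * X ^ E' + g) := by
    rw [hg]; ring
  rw [hrw]
  rcases hc'.eq_or_lt with hc'0 | hc'0
  · rw [← hc'0, C_0, zero_mul, zero_add]; exact hmid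
  rw [Literature.Algebra.Polynomial.signVariations_C_mul_X_pow_add hc'0.ne' hg'deg]
  rcases hc.eq_or_lt with hc0 | hc0
  · -- `c = 0`: `V = V(g) + [·] ≤ #supp R + 1`
    rw [← hc0, C_0, zero_mul, zero_add] at *
    calc g.signVariations + (if SignType.sign c' = -SignType.sign g.leadingCoeff then 1 else 0)
        ≤ g.signVariations + 1 := by gcongr; split_ifs <;> simp
      _ ≤ R.support.card + 1 := by omega
  · have hlead : (C c * X ^ E' + g).leadingCoeff = c := by
      rw [add_comm, leadingCoeff_add_of_degree_lt, leadingCoeff_C_mul_X_pow]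
      rwa [degree_C_mul_X_pow E' hc0.ne']
    rw [hlead, if_neg, add_zero]
    · exact hmid
    · rw [sign_pos hc'0, sign_pos hc0]; decide

/-! ### 4. Root counts -/

/-- The exponent image of the count vectors and its cardinality. [bookkeeping] -/
theorem card_image_sym_le (d : Fin K → ℕ) :
    ((Finset.univ : Finset (Sym (Fin K) (m + 1))).image
        (fun s : Sym (Fin K) (m + 1) => ((s : Multiset (Fin K)).map d).sum)).card ≤ Nat.choose (m + 1 + K - 1) (m + 1) :=
  calc _ ≤ (Finset.univ : Finset (Sym (Fin K) (m + 1))).card := Finset.card_image_le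
    _ = Nat.choose (m + 1 + K - 1) (m + 1) := by
        rw [Finset.card_univ, Sym.card_sym_eq_choose, Fintype.card_fin]; congr 1; omega

/-- Every exponent of a row-to-letter map lies in the exponent image of the count vectors. [bookkeeping] -/
theorem sum_mem_image_sym (d : Fin K → ℕ) (f : Fin (m + 1) → Fin K) :
    (∑ i, d (f i)) ∈ (Finset.univ : Finset (Sym (Fin K) (m + 1))).image
        (fun s : Sym (Fin K) (m + 1) => ((s : Multiset (Fin K)).map d).sum) :=
  Finset.mem_image.mpr ⟨⟨Finset.univ.val.map f, StubDescartesCeiling.card_map_univ_val f⟩, Finset.mem_univ _,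
    (StubDescartesCeiling.sum_eq_sym_sum d f).symm⟩

/-- **PSD letters at both ends: two below the ceiling.**  Size `m + 1`, `K` letters; `l₀, l₁` carry the strictly smallest / second smallest
exponents, `k₀, k₁` the strictly largest / second largest, `d l₁ < d k₁`, and `S l₀, S l₁, S k₀, S k₁ ⪰ 0` (the other letters
arbitrary real): `Z₊ ≤ C(m+K, m+1) − 3`. [folklore] -/
theorem card_posRoots_det_pencil_le_of_ends_posSemidef (d : Fin K → ℕ) (S : Fin K → Matrix (Fin (m + 1)) (Fin (m + 1)) ℝ)
    {l₀ l₁ k₀ k₁ : Fin K} (h01 : d l₀ < d l₁) (hbot : ∀ l, l ≠ l₀ → d l₀ < d l) (hnext : ∀ l, l ≠ l₀ → l ≠ l₁ → d l₁ < d l)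
    (hk01 : d k₁ < d k₀) (htopn : ∀ l, l ≠ k₀ → l ≠ k₁ → d l < d k₁) (hsep : d l₁ < d k₁)
    (hl₀ : (S l₀).PosSemidef) (hl₁ : (S l₁).PosSemidef) (hk₀ : (S k₀).PosSemidef) (hk₁ : (S k₁).PosSemidef) :
    ((Matrix.det (∑ l, ((X : ℝ[X]) ^ d l) • (S l).map C)).roots.toFinset.filter (fun t => 0 < t)).card
      ≤ Nat.choose (m + 1 + K - 1) (m + 1) - 3 := by
  classical
  set F := Matrix.det (∑ l, ((X : ℝ[X]) ^ d l) • (S l).map C) with hF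
  set D₀ := (m + 1) * d l₀
  set D₁ := m * d l₀ + d l₁
  set E₁ := m * d k₀ + d k₁
  set E₀ := (m + 1) * d k₀
  have hD : D₀ < D₁ := by simp only [D₀, D₁, Nat.succ_mul]; omega
  have hEE : E₁ < E₀ := by simp only [E₀, E₁, Nat.succ_mul]; omega
  have hDE : D₁ < E₁ := by
    simp only [D₁, E₁]
    have : d l₀ ≤ d k₀ := (h01.trans (hsep.trans hk01)).le
    nlinarith
  -- the four end coefficients
  have hc0 : F.coeff D₀ = (S l₀).det := coeff_det_pencil_bot d S hbot
  have hc1 : F.coeff D₁ = ((S l₀).adjugate * S l₁).trace := coeff_det_pencil_botNext d S h01 hnext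
  have hc2 : F.coeff E₁ = ((S k₀).adjugate * S k₁).trace := coeff_det_pencil_topNext d S hk01 htopn
  have hc3 : F.coeff E₀ = (S k₀).det :=
    coeff_det_pencil_top d S (k₀ := k₀) fun l hl => by
      by_cases h : l = k₁
      · rw [h]; exact hk01
      · exact (htopn l hl h).trans hk01
  set R := F - C (S l₀).det * X ^ D₀ - C ((S l₀).adjugate * S l₁).trace * X ^ D₁
    - C ((S k₀).adjugate * S k₁).trace * X ^ E₁ - C (S k₀).det * X ^ E₀ with hR
  have hFR : F = C (S l₀).det * X ^ D₀ + C ((S l₀).adjugate * S l₁).trace * X ^ D₁ + R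
      + C ((S k₀).adjugate * S k₁).trace * X ^ E₁ + C (S k₀).det * X ^ E₀ := by rw [hR]; ring
  have hRcoeff : ∀ i, R.coeff i = F.coeff i - (if i = D₀ then (S l₀).det else 0)
      - (if i = D₁ then ((S l₀).adjugate * S l₁).trace else 0)
      - (if i = E₁ then ((S k₀).adjugate * S k₁).trace else 0) - (if i = E₀ then (S k₀).det else 0) := by
    intro i
    rw [hR, coeff_sub, coeff_sub, coeff_sub, coeff_sub, coeff_C_mul_X_pow, coeff_C_mul_X_pow, coeff_C_mul_X_pow,
      coeff_C_mul_X_pow]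
  -- the support of `R` sits strictly between `D₁` and `E₁`, inside the support of `F`
  have hRsupp : ∀ i ∈ R.support, D₁ < i ∧ i < E₁ ∧ i ∈ F.support := by
    intro i hi
    have hne : R.coeff i ≠ 0 := mem_support_iff.mp hi
    rw [hRcoeff] at hne
    by_cases h0 : i = D₀
    · exfalso; apply hne; subst h0
      rw [if_pos rfl, if_neg hD.ne, if_neg (hD.trans hDE).ne, if_neg (hD.trans (hDE.trans hEE)).ne, hc0]; ring
    by_cases h1 : i = D₁
    · exfalso; apply hne; subst h1
      rw [if_neg hD.ne', if_pos rfl, if_neg hDE.ne, if_neg (hDE.trans hEE).ne, hc1]; ring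
    by_cases h2 : i = E₁
    · exfalso; apply hne; subst h2
      rw [if_neg (hD.trans hDE).ne', if_neg hDE.ne', if_pos rfl, if_neg hEE.ne, hc2]; ring
    by_cases h3 : i = E₀
    · exfalso; apply hne; subst h3
      rw [if_neg (hD.trans (hDE.trans hEE)).ne', if_neg (hDE.trans hEE).ne', if_neg hEE.ne', if_pos rfl, hc3]; ring
    rw [if_neg h0, if_neg h1, if_neg h2, if_neg h3] at hne
    have hiF : i ∈ F.support := mem_support_iff.mpr (by intro hz; apply hne; rw [hz]; ring)
    exact ⟨botNext_lt_of_mem_support d S h01 hnext hiF h0 h1, lt_topNext_of_mem_support d S hk01 htopn hiF h3 h2, hiF⟩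
  -- cardinality: `supp R ⊆ image \\ {D₀, D₁, E₁, E₀}`
  set I := (Finset.univ : Finset (Sym (Fin K) (m + 1))).image
      (fun s : Sym (Fin K) (m + 1) => ((s : Multiset (Fin K)).map d).sum) with hI
  have hD₀I : D₀ ∈ I := by simp only [D₀]; rw [← sum_const_letter d l₀]; exact sum_mem_image_sym d _
  have hD₁I : D₁ ∈ I := by
    simp only [D₁]; rw [← sum_update_letter d l₀ l₁ (0 : Fin (m + 1))]; exact sum_mem_image_sym d _
  have hE₀I : E₀ ∈ I := by simp only [E₀]; rw [← sum_const_letter d k₀]; exact sum_mem_image_sym d _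
  have hE₁I : E₁ ∈ I := by
    simp only [E₁]; rw [← sum_update_letter d k₀ k₁ (0 : Fin (m + 1))]; exact sum_mem_image_sym d _
  have hsub : R.support ⊆ (((I.erase D₀).erase D₁).erase E₁).erase E₀ := by
    intro i hi
    obtain ⟨h1, h2, hiF⟩ := hRsupp i hi
    refine Finset.mem_erase.mpr ⟨(h2.trans hEE).ne, Finset.mem_erase.mpr ⟨h2.ne, Finset.mem_erase.mpr ⟨h1.ne',
      Finset.mem_erase.mpr ⟨(hD.trans h1).ne', StubDescartesCeiling.support_det_pencil_subset d S hiF⟩⟩⟩⟩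
  have hcard := Finset.card_le_card hsub
  rw [Finset.card_erase_of_mem (Finset.mem_erase.mpr ⟨hEE.ne', Finset.mem_erase.mpr ⟨(hDE.trans hEE).ne',
      Finset.mem_erase.mpr ⟨(hD.trans (hDE.trans hEE)).ne', hE₀I⟩⟩⟩),
    Finset.card_erase_of_mem (Finset.mem_erase.mpr ⟨hDE.ne', Finset.mem_erase.mpr ⟨(hD.trans hDE).ne', hE₁I⟩⟩),
    Finset.card_erase_of_mem (Finset.mem_erase.mpr ⟨hD.ne', hD₁I⟩), Finset.card_erase_of_mem hD₀I] at hcard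
  have hIcard : I.card ≤ Nat.choose (m + 1 + K - 1) (m + 1) := card_image_sym_le d
  have hT : ({D₀, D₁, E₁, E₀} : Finset ℕ) ⊆ I := by
    intro x hx
    simp only [Finset.mem_insert, Finset.mem_singleton] at hx
    rcases hx with rfl | rfl | rfl | rfl <;> assumption
  have hT4 : ({D₀, D₁, E₁, E₀} : Finset ℕ).card = 4 := by
    have h1 : D₀ ≠ D₁ := hD.ne
    have h2 : D₀ ≠ E₁ := (hD.trans hDE).ne
    have h3 : D₀ ≠ E₀ := (hD.trans (hDE.trans hEE)).ne
    have h4 : D₁ ≠ E₁ := hDE.ne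
    have h5 : D₁ ≠ E₀ := (hDE.trans hEE).ne
    have h6 : E₁ ≠ E₀ := hEE.ne
    rw [Finset.card_insert_of_notMem (by simp [h1, h2, h3]), Finset.card_insert_of_notMem (by simp [h4, h5]),
      Finset.card_pair h6]
  have hI4 : 4 ≤ I.card := hT4 ▸ Finset.card_le_card hT
  have hV := signVariations_le_of_ends_nonneg hl₀.det_nonneg (trace_adjugate_mul_nonneg hl₀ hl₁)
    (trace_adjugate_mul_nonneg hk₀ hk₁) hk₀.det_nonneg hD hEE hDE (R := R) (fun i hi => (hRsupp i hi).1)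
    (fun i hi => (hRsupp i hi).2.1)
  rw [← hFR] at hV
  refine (WLawTwoChambers.card_posRoots_le_signVariations F).trans (hV.trans ?_)
  omega

/-- **Two PSD letters on top: one below the ceiling** (mirror of `WLawNotSharp.card_posRoots_det_pencil_le_of_bot_two_posSemidef`): `k₀, k₁` carry the
strictly largest / second largest exponents and `S k₀, S k₁ ⪰ 0` ⇒ `Z₊ ≤ C(m+K, m+1) − 2`. [folklore] -/
theorem card_posRoots_det_pencil_le_of_top_two_posSemidef (hK : 0 < K) (d : Fin K → ℕ)
    (S : Fin K → Matrix (Fin (m + 1)) (Fin (m + 1)) ℝ) {k₀ k₁ : Fin K} (hk01 : d k₁ < d k₀)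
    (htop : ∀ l, l ≠ k₀ → d l < d k₀) (htopn : ∀ l, l ≠ k₀ → l ≠ k₁ → d l < d k₁)
    (hk₀ : (S k₀).PosSemidef) (hk₁ : (S k₁).PosSemidef) :
    ((Matrix.det (∑ l, ((X : ℝ[X]) ^ d l) • (S l).map C)).roots.toFinset.filter (fun t => 0 < t)).card
      ≤ Nat.choose (m + 1 + K - 1) (m + 1) - 2 := by
  classical
  -- reflect the exponents: positive roots correspond under `t ↦ 1/t`
  have hN : ∀ l, d l ≤ d k₀ := fun l => by
    by_cases h : l = k₀
    · rw [h]
    · exact (htop l h).le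
  set F := Matrix.det (∑ l, ((X : ℝ[X]) ^ d l) • (S l).map C) with hF
  by_cases hF0 : F = 0
  · rw [hF0]; simp
  have hdeg : F.natDegree ≤ (m + 1) * d k₀ := by
    rw [natDegree_le_iff_coeff_eq_zero]
    intro i hi
    exact StubDescartesCeiling.coeff_det_pencil_eq_zero d S fun f hf =>
      absurd (hf.symm.le.trans (sum_le_mul d hN f)) (not_le.mpr hi)
  refine (Census.card_posRoots_le_card_posRoots_reflect F hF0 hdeg).trans ?_
  rw [← det_pencil_reflect_eq d S hN]
  exact card_posRoots_det_pencil_le_of_bot_two_posSemidef hK (fun l => d k₀ - d l) S (l₀ := k₀) (l₁ := k₁)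
    (by omega) (fun l hl => by have := htop l hl; omega)
    (fun l hl hl' => by have := htopn l hl hl'; have := hN l; omega) hk₀ hk₁

end PencilEnds

end Summit.ValiantsHypothesis.ValiantsHypothesis.Theorems.LacunarySymmetroidMatrixDescartes
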